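import Summits.Ventures.LatticeQCDFlow.Scaling.GraphSchemeWilsonFloor
import Summits.Ventures.LatticeQCDFlow.Scaling.HomStarPersistentLogFloor

/-!
HONEST FRAMING: exact (Metropolis-corrected) sampling algorithms for lattice gauge theory; figures
of merit are autocorrelation/cost numbers at stated couplings and volumes; no continuum-physics
claim.

# StarWilsonMode — THE STAR END OF THE INTERPOLATION: ON THE UNIFORM HUB LIST THE TWO-VALUE VECTOR `(x, 1, …, 1)` WITH `t(1−x)(K+x) = hKx` SOLVES THE VERTEX EQUATIONS WITH
# `ρ = t(1−x)/K = hx/(K+x)`, SO `1/ρ ≥ max{K/t, (K+1)/h}`, `1/ρ ≤ (K+1)(h+2t)/(ht)`, AND THE HOMOGENEOUS REPLICA-EXCHANGE STAR HAS THE LAW-FREE WILSON FLOOR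
# **`t_mix(1/4) ≥ (max{K/t, (K+1)/h} − 1)·log((1−ν(u))K/(4√((t+h)(K+1)(h+2t)/(ht))))`** (lean-2 GEN-47, ours)

Venture-side (OURS).  Cell `lqcd-flow` (pub-lqcd), unit `pub-lqcd-lean-2-g47`, 2026-08-31.  Chapter AH (the hub–ladder interpolation), file 3 — the second instance of file 2.  Setting of
chapters U ∕ AD ∕ AE: the homogeneous replica-exchange STAR `P = t·ptGraphSwap ν^{⊗} e 1 + (1−t)·prodKernel w M` on the hub list `e_r = (0, κ_r+1)` with every cold level listed exactly
`c` times (`m = cK`), one positive law `ν`, exact hot sampler, idle cold kernels, `h = (1−t)w_0`.  The vertex equations of file 1 for a vector `c` with `c_0 = x`, `c_{k+1} = 1` reduce to the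
leaf equation `(t/K)(x − 1) = −ρ` and the hub equation `t(1−x) − hx = −ρx`; with `ρ = t(1−x)/K` the latter is `t(1−x)(K+x) = hKx`, solved in `(0,1)` by the intermediate value theorem, and
then `ρ(K+x) = hx`, `ρ ≤ t/K`, `ρ ≤ h/(K+1)`, `1/ρ ≤ (K+1)(h+2t)/(ht)`.  File 2 with `Δ = 1`, `c_0² ≤ 1`, `D² = (t+h)/ρ`, `Σ_kc_k = x + K ≥ K` and chapter AF file 6's convergence of the
scheme give the floor — chapter AE file 18's law-free `(K(t+h)/(th))·log K`-type floor for the same scheme, re-derived through Wilson's statistic with the unit `max{K/t, (K+1)/h}`.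
No definitions.

* §1 `star_vertex_sum_leaf`, `star_vertex_sum_hub`, **`star_vertex_equations`**; §2 **`starMode_exists`** (IVT), `starMode_identity` (`tK = x(hK + tK + tx − t)`), **`starMode_rho_bounds`**;
  §3 **`homStar_wilson_mode_mixingTime_ge`** (`((1−ρ)/ρ)·log((1−ν(u))(x+K)/(4√((t+h)/ρ))) ≤ t_mix(1/4)`), **`homStar_wilson_mixingTime_ge`** (the packaged floor).

Reading (no numerics implied): the star (`1/ρ ≍ K·max{1/t, 1/h}`) and the path (`1/ρ ≍ max{K³/t, K/h}`, chapter AG) are the two computed ground states of the same matrix family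
`I − (t/m)L_G − h·e_0e_0ᵀ`; file 2 turns any such ground state into a mixing floor.  Literature grade (cell rule): OWN; nothing cited; no new bib keys.
-/

noncomputable section

open Finset Function Real
open Literature.Probability.MarkovChains

namespace Summit.Ventures.LatticeQCDFlow.Scaling

variable {S : Type*} [Fintype S] [DecidableEq S] {K m : ℕ} (κ : Fin m → Fin K) {ν : S → ℝ} {M : Fin (K + 1) → S → S → ℝ} {w : Fin (K + 1) → ℝ} {t : ℝ}
  {P : (Fin (K + 1) → S) → (Fin (K + 1) → S) → ℝ}

/-! ## §1 The vertex sums on the uniform hub list -/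

/-- At a leaf `i+1` the vertex sum of file 1 is `(multiplicity of the leaf)·(c_0 − c_{i+1})`. [ours] -/
theorem star_vertex_sum_leaf {cc : ℕ} (hunif : ∀ i : Fin K, (univ.filter fun r : Fin m => κ r = i).card = cc) (c : Fin (K + 1) → ℝ) (i : Fin K) :
    ∑ r : Fin m, ((if i.succ = ((fun r : Fin m => (((0 : Fin (K + 1)), (κ r).succ) : Fin (K + 1) × Fin (K + 1))) r).1
        then c ((fun r : Fin m => (((0 : Fin (K + 1)), (κ r).succ) : Fin (K + 1) × Fin (K + 1))) r).2 - c ((fun r : Fin m => (((0 : Fin (K + 1)), (κ r).succ) : Fin (K + 1) × Fin (K + 1))) r).1 else 0)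
      + (if i.succ = ((fun r : Fin m => (((0 : Fin (K + 1)), (κ r).succ) : Fin (K + 1) × Fin (K + 1))) r).2
        then c ((fun r : Fin m => (((0 : Fin (K + 1)), (κ r).succ) : Fin (K + 1) × Fin (K + 1))) r).1 - c ((fun r : Fin m => (((0 : Fin (K + 1)), (κ r).succ) : Fin (K + 1) × Fin (K + 1))) r).2 else 0))
      = cc * (c 0 - c i.succ) := by
  simp only [Fin.succ_ne_zero, if_false, zero_add]
  have e' : ∀ r : Fin m, (if i.succ = (κ r).succ then c 0 - c (κ r).succ else 0) = (if κ r = i then c 0 - c i.succ else 0) := by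
    intro r
    by_cases h : κ r = i
    · rw [if_pos (by rw [h]), if_pos h, h]
    · rw [if_neg (fun h' => h (Fin.succ_injective _ h').symm), if_neg h]
  simp_rw [e']
  rw [← Finset.sum_filter, sum_const, hunif i, nsmul_eq_mul]

/-- At the hub the vertex sum is `Σ_r (c_{κ_r+1} − c_0)`. [ours] -/
theorem star_vertex_sum_hub (c : Fin (K + 1) → ℝ) :
    ∑ r : Fin m, ((if (0 : Fin (K + 1)) = ((fun r : Fin m => (((0 : Fin (K + 1)), (κ r).succ) : Fin (K + 1) × Fin (K + 1))) r).1
        then c ((fun r : Fin m => (((0 : Fin (K + 1)), (κ r).succ) : Fin (K + 1) × Fin (K + 1))) r).2 - c ((fun r : Fin m => (((0 : Fin (K + 1)), (κ r).succ) : Fin (K + 1) × Fin (K + 1))) r).1 else 0)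
      + (if (0 : Fin (K + 1)) = ((fun r : Fin m => (((0 : Fin (K + 1)), (κ r).succ) : Fin (K + 1) × Fin (K + 1))) r).2
        then c ((fun r : Fin m => (((0 : Fin (K + 1)), (κ r).succ) : Fin (K + 1) × Fin (K + 1))) r).1 - c ((fun r : Fin m => (((0 : Fin (K + 1)), (κ r).succ) : Fin (K + 1) × Fin (K + 1))) r).2 else 0))
      = ∑ r : Fin m, (c (κ r).succ - c 0) := by
  refine sum_congr rfl fun r _ => ?_
  simp only [if_true, (Fin.succ_ne_zero (κ r)).symm, if_false, add_zero]

/-- **A VECTOR WITH `c_0 = x`, `c_{k+1} = 1` SOLVES THE VERTEX EQUATIONS** of the uniform hub list (`m = cK`, `K ≥ 1`) with `ρ = t(1−x)/K` and hub weight `h`, given the scalar equation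
`t(1−x)(K+x) = hKx`. [ours] -/
theorem star_vertex_equations (hK : 1 ≤ K) {cc : ℕ} (hcc : 1 ≤ cc) (hunif : ∀ i : Fin K, (univ.filter fun r : Fin m => κ r = i).card = cc) (hmc : m = cc * K)
    {c : Fin (K + 1) → ℝ} {x hh ρ : ℝ} (hc0 : c 0 = x) (hck : ∀ i : Fin K, c i.succ = 1) (hρ : ρ = t * (1 - x) / K) (hx : t * (1 - x) * (K + x) = hh * K * x)
    (k : Fin (K + 1)) :
    t / m * ∑ r : Fin m, ((if k = ((fun r : Fin m => (((0 : Fin (K + 1)), (κ r).succ) : Fin (K + 1) × Fin (K + 1))) r).1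
        then c ((fun r : Fin m => (((0 : Fin (K + 1)), (κ r).succ) : Fin (K + 1) × Fin (K + 1))) r).2 - c ((fun r : Fin m => (((0 : Fin (K + 1)), (κ r).succ) : Fin (K + 1) × Fin (K + 1))) r).1 else 0)
      + (if k = ((fun r : Fin m => (((0 : Fin (K + 1)), (κ r).succ) : Fin (K + 1) × Fin (K + 1))) r).2
        then c ((fun r : Fin m => (((0 : Fin (K + 1)), (κ r).succ) : Fin (K + 1) × Fin (K + 1))) r).1 - c ((fun r : Fin m => (((0 : Fin (K + 1)), (κ r).succ) : Fin (K + 1) × Fin (K + 1))) r).2 else 0))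
      - (if k = 0 then hh * c 0 else 0) = -ρ * c k := by
  have hKpos : (0 : ℝ) < K := Nat.cast_pos.mpr (by omega)
  have hccpos : (0 : ℝ) < cc := Nat.cast_pos.mpr (by omega)
  have hm' : (m : ℝ) = cc * K := by rw [hmc]; push_cast; ring
  refine Fin.cases ?_ (fun i => ?_) k
  · -- the hub
    rw [star_vertex_sum_hub κ c, if_pos rfl, hc0]
    simp_rw [hck]
    rw [sum_const, card_univ, Fintype.card_fin, nsmul_eq_mul, hρ, hm']
    have hm0 : (cc : ℝ) * K ≠ 0 := by positivity
    field_simp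
    linear_combination hx
  · -- a leaf
    rw [star_vertex_sum_leaf κ hunif c i, if_neg (Fin.succ_ne_zero i), hc0, hck i, hρ, hm', sub_zero]
    field_simp
    ring

/-! ## §2 The scalar equation -/

/-- **EXISTENCE OF THE STAR MODE:** `K ≥ 1`, `t > 0`, `h > 0` ⇒ some `x ∈ (0,1)` solves `t(1−x)(K+x) = hKx`. [ours] -/
theorem starMode_exists (hK : 1 ≤ K) (ht : 0 < t) {hh : ℝ} (hhh : 0 < hh) :
    ∃ x : ℝ, 0 < x ∧ x < 1 ∧ t * (1 - x) * (K + x) = hh * K * x := by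
  have hKpos : (0 : ℝ) < K := Nat.cast_pos.mpr (by omega)
  set g : ℝ → ℝ := fun x => t * (1 - x) * (K + x) - hh * K * x with hg
  have hcont : ContinuousOn g (Set.Icc 0 1) := by apply Continuous.continuousOn; rw [hg]; fun_prop
  have hg0 : g 0 = t * K := by simp [hg]
  have hg1 : g 1 = -(hh * K) := by simp [hg]
  have hmem : (0 : ℝ) ∈ Set.Icc (g 1) (g 0) := ⟨by rw [hg1]; nlinarith, by rw [hg0]; positivity⟩
  obtain ⟨x, ⟨hx0, hx1⟩, hx⟩ := intermediate_value_Icc' zero_le_one hcont hmem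
  have hne0 : x ≠ 0 := by rintro rfl; rw [hg0] at hx; nlinarith
  have hne1 : x ≠ 1 := by rintro rfl; rw [hg1] at hx; nlinarith
  refine ⟨x, lt_of_le_of_ne hx0 (Ne.symm hne0), lt_of_le_of_ne hx1 hne1, ?_⟩
  have : g x = 0 := hx
  simp only [hg] at this
  linarith

/-- The scalar equation rearranged: `tK = x·(hK + tK + tx − t)`. [ours] -/
theorem starMode_identity {hh x : ℝ} (hx : t * (1 - x) * (K + x) = hh * K * x) : t * K = x * (hh * K + t * K + t * x - t) := by
  linear_combination hx

/-- **THE RATE OF THE STAR MODE:** with `ρ = t(1−x)/K` and the scalar equation: `ρ(K+x) = hx`, `0 < ρ`, `ρ ≤ t/K`, `ρ ≤ h/(K+1)`, `1/ρ ≤ (K+1)(h+2t)/(ht)`. [ours] -/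
theorem starMode_rho_bounds (hK : 1 ≤ K) (ht : 0 < t) {hh x ρ : ℝ} (hhh : 0 < hh) (hx0 : 0 < x) (hx1 : x < 1) (hx : t * (1 - x) * (K + x) = hh * K * x)
    (hρ : ρ = t * (1 - x) / K) :
    ρ * (K + x) = hh * x ∧ 0 < ρ ∧ ρ ≤ t / K ∧ ρ ≤ hh / ((K : ℝ) + 1) ∧ 1 / ρ ≤ ((K : ℝ) + 1) * (hh + 2 * t) / (hh * t) := by
  have hKpos : (0 : ℝ) < K := Nat.cast_pos.mpr (by omega)
  have hK1 : (1 : ℝ) ≤ K := by exact_mod_cast hK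
  have hρ0 : 0 < ρ := by rw [hρ]; exact div_pos (by nlinarith) hKpos
  have hρx : ρ * (K + x) = hh * x := by
    rw [hρ]; field_simp; linear_combination hx
  -- `ρ ≤ h`
  have hρh : ρ ≤ hh := by
    have : ρ * (K + x) ≤ hh * (K + x) := by rw [hρx]; nlinarith
    exact le_of_mul_le_mul_right this (by linarith)
  refine ⟨hρx, hρ0, ?_, ?_, ?_⟩
  · rw [hρ]; exact div_le_div_of_nonneg_right (by nlinarith) hKpos.le
  · -- `ρ(K+1) = hx + ρ(1−x) ≤ hx + h(1−x) = h`
    rw [le_div_iff₀ (by positivity)]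
    have : ρ * (1 - x) ≤ hh * (1 - x) := mul_le_mul_of_nonneg_right hρh (by linarith)
    nlinarith
  · -- `x ≥ tK/(hK + t(K+1))` and `1/ρ = (K+x)/(hx)`
    have hid := starMode_identity (t := t) (K := K) hx
    have hxlow : t * K ≤ x * (hh * K + t * (K + 1)) := by
      have : x * (hh * K + t * K + t * x - t) ≤ x * (hh * K + t * (K + 1)) := by
        apply mul_le_mul_of_nonneg_left _ hx0.le; nlinarith
      linarith
    rw [div_le_div_iff₀ hρ0 (by positivity), one_mul]
    -- `h t ≤ (K+1)(h+2t) ρ`: multiply `hxlow` by `h` and use `ρ(K+x) = hx`, `K + x ≤ K + 1`, `hK + t(K+1) ≤ (h+2t)K`... assembled: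
    have h1 : hh * t * K ≤ hh * x * (hh * K + t * (K + 1)) := by nlinarith
    rw [← hρx] at h1
    -- `ρ(K+x)(hK + t(K+1)) ≤ ρ (K+1) (h+2t) K`
    have h2 : (K + x) * (hh * K + t * (K + 1)) ≤ ((K : ℝ) + 1) * (hh + 2 * t) * K := by
      have hKx : K + x ≤ (K : ℝ) + 1 := by linarith
      have hin : hh * K + t * (K + 1) ≤ (hh + 2 * t) * K := by nlinarith
      calc (K + x) * (hh * K + t * (K + 1)) ≤ ((K : ℝ) + 1) * (hh * K + t * (K + 1)) := mul_le_mul_of_nonneg_right hKx (by positivity)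
        _ ≤ ((K : ℝ) + 1) * ((hh + 2 * t) * K) := mul_le_mul_of_nonneg_left hin (by positivity)
        _ = _ := by ring
    have h3 : ρ * ((K + x) * (hh * K + t * (K + 1))) ≤ ρ * (((K : ℝ) + 1) * (hh + 2 * t) * K) := mul_le_mul_of_nonneg_left h2 hρ0.le
    have h4 : hh * t * K ≤ ρ * (((K : ℝ) + 1) * (hh + 2 * t) * K) := by linarith [h1, h3]
    have h5 : hh * t ≤ ρ * (((K : ℝ) + 1) * (hh + 2 * t)) := le_of_mul_le_mul_right (by linarith [h4]) hKpos
    linarith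

/-! ## §3 The Wilson floor for the homogeneous star -/

/-- **THE FLOOR AT THE STAR MODE:** uniform hub list (`c ≥ 1` copies of each hub edge, `m = cK`), `K ≥ 1`, `0 < t < 1`, `w_0 > 0`, `h = (1−t)w_0`, one positive law `ν`, exact hot sampler, idle
cold kernels, `x` a root of `t(1−x)(K+x) = hKx` in `(0,1)`, `ρ = t(1−x)/K`; then for every `u`: **`((1−ρ)/ρ)·log((1−ν(u))·|x + K|/(4√((t+h)/ρ))) ≤ t_mix(1/4)`**. [ours] -/
theorem homStar_wilson_mode_mixingTime_ge (hK : 1 ≤ K) (hm : 1 ≤ m) {cc : ℕ} (hcc : 1 ≤ cc) (hunif : ∀ i : Fin K, (univ.filter fun r : Fin m => κ r = i).card = cc)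
    (hmc : m = cc * K) (hν : ∀ v, 0 < ν v) (hν1 : ∑ v, ν v = 1) (hM0 : ∀ u v, M 0 u v = ν v) (hidle : ∀ i : Fin K, ∀ u v, M i.succ u v = if v = u then 1 else 0)
    (hw0 : ∀ k, 0 ≤ w k) (hw00 : 0 < w 0) (hw1 : ∑ k, w k = 1) (ht0 : 0 < t) (ht1 : t < 1)
    (hP : ∀ x y, P x y = t * ptGraphSwap (fun _ : Fin (K + 1) => ν) (fun r : Fin m => (((0 : Fin (K + 1)), (κ r).succ) : Fin (K + 1) × Fin (K + 1))) (fun _ => Equiv.refl S) x y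
      + (1 - t) * prodKernel w M x y)
    {x ρ : ℝ} (hx0 : 0 < x) (hx1 : x < 1) (hx : t * (1 - x) * (K + x) = (1 - t) * w 0 * K * x) (hρ : ρ = t * (1 - x) / K) (u : S) :
    (1 - ρ) / ρ * Real.log ((1 - ν u) * |x + K| / (4 * Real.sqrt ((t + (1 - t) * w 0) / ρ))) ≤ (mixingTime P (tensorFun (fun _ : Fin (K + 1) => ν)) (1 / 4) : ℝ) := by
  have hKpos : (0 : ℝ) < K := Nat.cast_pos.mpr (by omega)
  have hhh : 0 < (1 - t) * w 0 := mul_pos (by linarith) hw00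
  obtain ⟨hρx, hρ0, hρt, hρh, hinv⟩ := starMode_rho_bounds hK ht0 hhh hx0 hx1 hx hρ
  have hρ1 : ρ < 1 := by
    have : t / (K : ℝ) ≤ t := div_le_self ht0.le (by exact_mod_cast hK)
    linarith
  -- convergence of the scheme (chapter AF file 6)
  have hμ : ∀ (k : Fin (K + 1)) (v : S), 0 < (fun _ : Fin (K + 1) => ν) k v := fun _ v => hν v
  obtain ⟨_, _, hconv⟩ := homStar_exists_worstTvDist_le κ (μ := fun _ : Fin (K + 1) => ν) (M := M) (w := w) (t := t) hm hμ (fun _ => hν1) hw0 hw00 hw1 ht0 ht1 hM0 hidle hunif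
    (show (0 : ℝ) < 1 / 4 by norm_num)
  have eP : P = fun x y => t * ptGraphSwap (fun _ : Fin (K + 1) => ν) (fun r : Fin m => (((0 : Fin (K + 1)), (κ r).succ) : Fin (K + 1) × Fin (K + 1))) (fun _ => Equiv.refl S) x y
      + (1 - t) * prodKernel w M x y := funext fun x => funext fun y => hP x y
  rw [← eP] at hconv
  -- file 2 with the two-value vector
  set cv : Fin (K + 1) → ℝ := fun k => if k = 0 then x else 1 with hcv
  have hc0 : cv 0 = x := by simp [hcv]
  have hck : ∀ i : Fin K, cv i.succ = 1 := fun i => by simp [hcv, Fin.succ_ne_zero]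
  set D : ℝ := Real.sqrt ((t + (1 - t) * w 0) / ρ) with hD
  have hD0 : 0 < D := Real.sqrt_pos.mpr (by positivity)
  have hD2 : (t * 1 + (1 - t) * w 0 * cv 0 ^ 2) / ρ ≤ D ^ 2 := by
    rw [hD, Real.sq_sqrt (by positivity), hc0]
    refine div_le_div_of_nonneg_right ?_ hρ0.le
    have hx2 : x ^ 2 ≤ 1 := by nlinarith
    nlinarith [mul_le_mul_of_nonneg_left hx2 hhh.le]
  have hΔ : ∀ r : Fin m, (cv ((fun r : Fin m => (((0 : Fin (K + 1)), (κ r).succ) : Fin (K + 1) × Fin (K + 1))) r).1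
      - cv ((fun r : Fin m => (((0 : Fin (K + 1)), (κ r).succ) : Fin (K + 1) × Fin (K + 1))) r).2) ^ 2 ≤ 1 := by
    intro r; dsimp only; rw [hc0, hck]; nlinarith
  have hfloor := graphScheme_mode_mixingTime_ge (fun r : Fin m => (((0 : Fin (K + 1)), (κ r).succ) : Fin (K + 1) × Fin (K + 1))) hm (hubList_fst_ne_snd κ) hν hν1 hM0 hidle hw0 hw1
    ht0 ht1 hP (c := cv) (ρ := ρ) (Δ := 1) (fun k => star_vertex_equations κ hK hcc hunif hmc hc0 hck hρ hx k) hρ0 hρ1 hΔ hconv hD0 hD2 u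
  have hsum : ∑ k : Fin (K + 1), cv k = x + K := by
    rw [Fin.sum_univ_succ, hc0]; simp_rw [hck]; simp
  rw [hsum] at hfloor
  exact hfloor

/-- **THE LAW-FREE WILSON FLOOR FOR THE HOMOGENEOUS REPLICA-EXCHANGE STAR, PACKAGED:** under the hypotheses of `homStar_wilson_mode_mixingTime_ge` (no root needed), for every content `u`
with `ν(u) < 1`: **`(max{K/t, (K+1)/h} − 1)·log((1−ν(u))K/(4√((t+h)(K+1)(h+2t)/(ht)))) ≤ t_mix(1/4)`**, `h = (1−t)w_0`. [ours] -/
theorem homStar_wilson_mixingTime_ge (hK : 1 ≤ K) (hm : 1 ≤ m) {cc : ℕ} (hcc : 1 ≤ cc) (hunif : ∀ i : Fin K, (univ.filter fun r : Fin m => κ r = i).card = cc)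
    (hmc : m = cc * K) (hν : ∀ v, 0 < ν v) (hν1 : ∑ v, ν v = 1) (hM0 : ∀ u v, M 0 u v = ν v) (hidle : ∀ i : Fin K, ∀ u v, M i.succ u v = if v = u then 1 else 0)
    (hw0 : ∀ k, 0 ≤ w k) (hw00 : 0 < w 0) (hw1 : ∑ k, w k = 1) (ht0 : 0 < t) (ht1 : t < 1)
    (hP : ∀ x y, P x y = t * ptGraphSwap (fun _ : Fin (K + 1) => ν) (fun r : Fin m => (((0 : Fin (K + 1)), (κ r).succ) : Fin (K + 1) × Fin (K + 1))) (fun _ => Equiv.refl S) x y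
      + (1 - t) * prodKernel w M x y) (u : S) (hu : ν u < 1) :
    (max ((K : ℝ) / t) (((K : ℝ) + 1) / ((1 - t) * w 0)) - 1)
        * Real.log ((1 - ν u) * K / (4 * Real.sqrt ((t + (1 - t) * w 0) * ((K : ℝ) + 1) * ((1 - t) * w 0 + 2 * t) / ((1 - t) * w 0 * t))))
      ≤ (mixingTime P (tensorFun (fun _ : Fin (K + 1) => ν)) (1 / 4) : ℝ) := by
  have hKpos : (0 : ℝ) < K := Nat.cast_pos.mpr (by omega)
  have hK1 : (1 : ℝ) ≤ K := by exact_mod_cast hK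
  set hh : ℝ := (1 - t) * w 0 with hhdef
  have hhh : 0 < hh := mul_pos (by linarith) hw00
  obtain ⟨x, hx0, hx1, hx⟩ := starMode_exists hK ht0 hhh
  set ρ : ℝ := t * (1 - x) / K with hρ
  obtain ⟨hρx, hρ0, hρt, hρh, hinv⟩ := starMode_rho_bounds hK ht0 hhh hx0 hx1 hx hρ
  have hx' : t * (1 - x) * (K + x) = (1 - t) * w 0 * K * x := by rw [← hhdef]; exact hx
  have hmode := homStar_wilson_mode_mixingTime_ge κ hK hm hcc hunif hmc hν hν1 hM0 hidle hw0 hw00 hw1 ht0 ht1 hP hx0 hx1 hx' hρ u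
  rw [← hhdef] at hmode
  have h1ν : 0 < 1 - ν u := by linarith
  -- the argument of the logarithm is smaller
  set B : ℝ := (t + hh) * ((K : ℝ) + 1) * (hh + 2 * t) / (hh * t) with hB
  have hB0 : 0 < B := by rw [hB]; positivity
  have hDB : Real.sqrt ((t + hh) / ρ) ≤ Real.sqrt B := by
    refine Real.sqrt_le_sqrt ?_
    rw [hB]
    calc (t + hh) / ρ = (t + hh) * (1 / ρ) := by ring
      _ ≤ (t + hh) * (((K : ℝ) + 1) * (hh + 2 * t) / (hh * t)) := mul_le_mul_of_nonneg_left hinv (by positivity)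
      _ = _ := by ring
  have hS0 : 0 < Real.sqrt ((t + hh) / ρ) := Real.sqrt_pos.mpr (by positivity)
  have harg : (1 - ν u) * K / (4 * Real.sqrt B) ≤ (1 - ν u) * |x + K| / (4 * Real.sqrt ((t + hh) / ρ)) := by
    rw [abs_of_pos (by positivity)]
    calc (1 - ν u) * K / (4 * Real.sqrt B) ≤ (1 - ν u) * (x + K) / (4 * Real.sqrt B) :=
          div_le_div_of_nonneg_right (by nlinarith) (by positivity)
      _ ≤ (1 - ν u) * (x + K) / (4 * Real.sqrt ((t + hh) / ρ)) :=
          div_le_div_of_nonneg_left (by positivity) (by positivity) (by linarith)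
  have hlog : Real.log ((1 - ν u) * K / (4 * Real.sqrt B)) ≤ Real.log ((1 - ν u) * |x + K| / (4 * Real.sqrt ((t + hh) / ρ))) :=
    Real.log_le_log (by positivity) harg
  -- the coefficient is smaller and non-negative
  have hcoef : max ((K : ℝ) / t) (((K : ℝ) + 1) / hh) - 1 ≤ (1 - ρ) / ρ := by
    have h3 : (1 - ρ) / ρ = 1 / ρ - 1 := by field_simp
    rw [h3]
    have ha : (K : ℝ) / t ≤ 1 / ρ := by
      rw [div_le_div_iff₀ ht0 hρ0, one_mul]
      have := (le_div_iff₀ hKpos).mp (le_of_eq rfl : t / K ≤ t / K)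
      calc (K : ℝ) * ρ ≤ K * (t / K) := mul_le_mul_of_nonneg_left hρt hKpos.le
        _ = t := by field_simp
    have hb : ((K : ℝ) + 1) / hh ≤ 1 / ρ := by
      rw [div_le_div_iff₀ hhh hρ0, one_mul]
      calc ((K : ℝ) + 1) * ρ ≤ ((K : ℝ) + 1) * (hh / ((K : ℝ) + 1)) := mul_le_mul_of_nonneg_left hρh (by positivity)
        _ = hh := by field_simp
    linarith [max_le ha hb]
  have hcoef0 : 0 ≤ max ((K : ℝ) / t) (((K : ℝ) + 1) / hh) - 1 := by
    have : 1 ≤ (K : ℝ) / t := by rw [le_div_iff₀ ht0]; nlinarith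
    linarith [le_max_left ((K : ℝ) / t) (((K : ℝ) + 1) / hh)]
  have hρ1 : ρ < 1 := by
    have : t / (K : ℝ) ≤ t := div_le_self ht0.le hK1
    linarith
  by_cases hL : 0 ≤ Real.log ((1 - ν u) * K / (4 * Real.sqrt B))
  · calc (max ((K : ℝ) / t) (((K : ℝ) + 1) / hh) - 1) * Real.log ((1 - ν u) * K / (4 * Real.sqrt B))
        ≤ (1 - ρ) / ρ * Real.log ((1 - ν u) * |x + K| / (4 * Real.sqrt ((t + hh) / ρ))) :=
          mul_le_mul hcoef hlog hL (div_nonneg (by linarith) hρ0.le)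
      _ ≤ _ := hmode
  · push Not at hL
    exact le_trans (mul_nonpos_of_nonneg_of_nonpos hcoef0 hL.le) (Nat.cast_nonneg _)

end Summit.Ventures.LatticeQCDFlow.Scaling

end
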